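import Summits.ResolutionOfSingularities.ResolutionOfSingularities.Theorems.FrobeniusClosingPatchingRelPerfectDepthLegalStepAPoint
import Literature.AlgebraicGeometry.Resolution.EmbeddedResolutionExcellentSurfacesSequence
import Literature.AlgebraicGeometry.Resolution.AlterationsNormalFormBlowupParts
import Literature.AlgebraicGeometry.Resolution.BlowupDisjointCentreSplitting
import Literature.AlgebraicGeometry.Resolution.RegularCentreComponents
import Literature.AlgebraicGeometry.Resolution.GenericPointsOfClosure
import Literature.AlgebraicGeometry.Resolution.GenericPointStalkData
import Literature.AlgebraicGeometry.Resolution.EtaleVanishingIdeal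
import Literature.AlgebraicGeometry.Resolution.MaximalPoints
import Mathlib.RingTheory.RegularLocalRing.Defs
import HarnessLib

/-!
# Crux `PatchingRelPerfect` (stmt-ResolutionOfSingularities-16161), chain W5.2 — T6-E1b residual `LegalScopedDivisorReduction₃`,
# PHASE 2 closer (2b), brick B4/A3: STEP A — THE CENTRES OF COSSART–JANNSEN–SAITO ON THE TRACE CURVE ARE CLOSED POINTS; THE POINTS LOOP

[OURS · L1 W5.2 · res-L1-w52-stub-1 g4 for B4 «STEP A» (plan-1 NAMING N7; lead-1 `PHASE2-SEPARATION-GAME.md` v2)] Replaces the role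
of NO printed item; NOT a statement of the manuscript under review; fact-free.

§9 NO CURVE CENTRES.  Along the transport the CJS surface `Z ≅ V(D)` carries the closed strict transform `XC` of the trace curve with
⟨LOWER `e⁻¹ XC ⊆ Supp T`, (NB) `XC ⊆ cl(XC ∖ B)`⟩.  Since every point of `Supp D ∩ Supp M` has codimension `> 1` in the threefold
`E` (`dim E ≤ 3`), `XC` has NO specialisation chain of length two (`eq_or_eq_of_specializes_of_coheight`); hence a NON-closed point
`ξ` of a CJS centre `V(C) ⊆ XC` would be a maximal point of `XC`, where the reduced stalk `𝒪_{Z,ξ}/𝓘(XC)_ξ` is the residue FIELD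
(`radical_stalkIdeal_eq_maximalIdeal_of_mem_maxPoints`) — regular — and which is a specialisation of a point of `XC ∖ B`
(`exists_mem_inter_specializes_of_mem_closure`), i.e. lies off `B`: both disjuncts of the (6.2)/Thm. 6.9 (a) clause «singular or on
the boundary» fail.  So **every point of a CJS centre is a closed point of the trace** (`isClosed_singleton_of_mem_centre`), and the
connected pieces of the centre are single closed points (`exists_eq_singleton_of_forall_isClosed`).

§10 THE POINTS LOOP (`HostState.points_loop`): a blowing up `τ` of `Z` along a regular centre whose piece partition consists of closed
points over the trace is re-sequenced point by point (P2 `IsBlowup.exists_comp_eq_of_isPiecePartition_cons`), each point lifted by A2's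
`point_step`; the remaining points stay single closed points over the trace (the first blow-up is an isomorphism off its point), and the
UPPER/LOWER trace bookkeeping composes.

AI-written; AI review is weaker than expert review.

## References
* V. Cossart, U. Jannsen, S. Saito, LNM 2270 (2020), (6.2), Def. 6.8, Thm. 6.9 (a). [CossartJannsenSaito2020]
* E. Bierstone, D. Grigoriev, P. Milman, J. Włodarczyk, arXiv:1206.3090, §4 Step 2b. [BierstoneGrigorievMilmanWlodarczyk2011]
* The Stacks Project, Tags 01J7, 02OS, 080A, 0052. [StacksProject]
-/

-- `Summit.<Summit>.<Sub>.Theorems` with `Sub = Summit` (single-conjunct summit, D-0017)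
set_option linter.dupNamespace false

noncomputable section

open CategoryTheory AlgebraicGeometry TopologicalSpace IsLocalRing
open Literature.AlgebraicGeometry.Resolution Scheme.IdealSheafData

namespace Summit.ResolutionOfSingularities.ResolutionOfSingularities.Theorems

universe u

namespace DepthLegal

open WeightTwoB DepthTargets

/-! ## §9 The centres of Cossart–Jannsen–Saito on the trace curve are closed points -/

section NoCurveCentres

/-- **No specialisation chain of length two among points of codimension `> 1` of a scheme of dimension `≤ 3`.** [folklore] -/
theorem eq_or_eq_of_specializes_of_coheight {E : Scheme.{u}} (hdim : topologicalKrullDim E ≤ 3) {S : Set E}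
    (hS : ∀ x ∈ S, 1 < Order.coheight x) {a b c : E} (ha : a ∈ S) (hab : a ⤳ b) (hbc : b ⤳ c) :
    a = b ∨ b = c := by
  by_contra h
  rw [not_or] at h
  obtain ⟨hab', hbc'⟩ := h
  -- strict inequalities `b < a`, `c < b` in the specialisation order
  have hba : b < a := lt_of_le_not_ge (Scheme.le_iff_specializes.mpr hab) fun h' =>
    hab' (Specializes.antisymm hab (Scheme.le_iff_specializes.mp h')).eq
  have hcb : c < b := lt_of_le_not_ge (Scheme.le_iff_specializes.mpr hbc) fun h' =>
    hbc' (Specializes.antisymm hbc (Scheme.le_iff_specializes.mp h')).eq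
  have h1 : Order.coheight a + 1 ≤ Order.coheight b := Order.coheight_add_one_le hba
  have h2 : Order.coheight b + 1 ≤ Order.coheight c := Order.coheight_add_one_le hcb
  have h3 : Order.coheight c ≤ 3 := (topologicalKrullDim_le_iff_forall_coheight_le E 3).mp hdim c
  have ha2 : 1 < Order.coheight a := hS a ha
  -- all three codimensions are finite
  have hcfin : Order.coheight c ≠ ⊤ := by
    intro e; rw [e] at h3; exact absurd h3 (by decide)
  obtain ⟨nc, hnc⟩ := ENat.ne_top_iff_exists.mp hcfin
  have hbfin : Order.coheight b ≠ ⊤ := by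
    intro e; rw [e, ← hnc] at h2; exact absurd h2 (by simp)
  obtain ⟨nb, hnb⟩ := ENat.ne_top_iff_exists.mp hbfin
  have hafin : Order.coheight a ≠ ⊤ := by
    intro e; rw [e, ← hnb] at h1; exact absurd h1 (by simp)
  obtain ⟨na, hna⟩ := ENat.ne_top_iff_exists.mp hafin
  rw [← hna, ← hnb] at h1
  rw [← hnb, ← hnc] at h2
  rw [← hnc] at h3
  rw [← hna] at ha2
  have h1' : na + 1 ≤ nb := by exact_mod_cast h1
  have h2' : nb + 1 ≤ nc := by exact_mod_cast h2
  have h3' : nc ≤ 3 := by exact_mod_cast h3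
  have ha2' : 1 < na := by exact_mod_cast ha2
  omega

/-- **No specialisation chain of length two in the strict transform of the trace curve**: the CJS surface `Z ≅ V(D)` with LOWER
`e⁻¹ XC ⊆ Supp T` inherits the statement through the continuous injection `ι ∘ e⁻¹ : Z → E`. [folklore] -/
theorem eq_or_eq_of_specializes_of_lower {E : Scheme.{u}} (hdim : topologicalKrullDim E ≤ 3) {D : E.IdealSheafData}
    {L : List (E.IdealSheafData × ℕ)} (hcurve : ∀ x ∈ D.support, x ∈ (monomialIdeal L).support → 1 < Order.coheight x)
    {Z : Scheme.{u}} (e : D.subscheme ≅ Z) {XC : Set Z}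
    (hL : ∀ z : Z, z ∈ XC → e.inv z ∈ (((monomialIdeal L).comap D.subschemeι).support : Set D.subscheme))
    {a b c : Z} (ha : a ∈ XC) (hab : a ⤳ b) (hbc : b ⤳ c) : a = b ∨ b = c := by
  set f : Z → E := fun z => D.subschemeι (e.inv z) with hf
  have hfc : Continuous f := D.subschemeι.continuous.comp e.inv.continuous
  have hfi : Function.Injective f := fun z z' h => by
    have h1 : e.inv z = e.inv z' := D.subschemeι.isClosedEmbedding.injective h
    have h2 := congrArg e.hom h1
    rwa [hom_inv_apply, hom_inv_apply] at h2
  have hS : ∀ x ∈ (D.support : Set E) ∩ (monomialIdeal L).support, 1 < Order.coheight x := fun x hx => hcurve x hx.1 hx.2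
  have ha' : f a ∈ (D.support : Set E) ∩ (monomialIdeal L).support := by
    refine ⟨subschemeι_apply_mem_support D (e.inv a), ?_⟩
    have h := hL a ha
    rw [Scheme.IdealSheafData.support_comap, Closeds.coe_preimage] at h
    exact h
  rcases eq_or_eq_of_specializes_of_coheight hdim hS ha' (hab.map hfc) (hbc.map hfc) with h | h
  · exact Or.inl (hfi h)
  · exact Or.inr (hfi h)

/-- [OURS · L1 W5.2] **EVERY POINT OF A CJS CENTRE ON THE TRACE CURVE IS A CLOSED POINT OF THE TRACE** (§9 of the module docstring): with
(NB) `XC ⊆ cl(XC ∖ B)` and no specialisation chain of length two in `XC`, a point of a centre `V(C) ⊆ cl XC = XC` each of whose points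
is «singular on `XC` or on `B`» is closed. [cite: CossartJannsenSaito2020, (6.2), Thm. 6.9 (a)] [cite: StacksProject, Tag 01J7] -/
theorem isClosed_singleton_of_mem_centre {Z : Scheme.{u}} [IsNoetherian Z] {XC B : Set Z} (hXCc : IsClosed XC) (hBc : IsClosed B)
    (hNB : XC ⊆ closure (XC \ B)) (hchain : ∀ a b c : Z, a ∈ XC → a ⤳ b → b ⤳ c → a = b ∨ b = c)
    {C : Z.IdealSheafData} (hsub : vanishingIdeal ⟨closure XC, isClosed_closure⟩ ≤ C)
    (hBsing : ∀ x ∈ (C.support : Set Z), ¬ IsRegularLocalRing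
      ((Z.presheaf.stalk x) ⧸ stalkIdeal (vanishingIdeal ⟨closure XC, isClosed_closure⟩) x) ∨ x ∈ B)
    {ξ : Z} (hξ : ξ ∈ (C.support : Set Z)) : IsClosed ({ξ} : Set Z) ∧ ξ ∈ XC := by
  have hcl : closure XC = XC := hXCc.closure_eq
  have hξX : ξ ∈ XC := by
    have h : ξ ∈ ((vanishingIdeal (⟨closure XC, isClosed_closure⟩ : Closeds Z)).support : Set Z) := support_antitone hsub hξ
    rw [Scheme.IdealSheafData.coe_support_vanishingIdeal] at h
    change ξ ∈ closure XC at h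
    rwa [hcl] at h
  refine ⟨?_, hξX⟩
  by_contra hnc
  -- a closed point `η ≠ ξ` in the closure of `ξ`
  obtain ⟨η, hη, hηc⟩ := (isClosed_closure (s := ({ξ} : Set Z))).exists_closed_singleton ⟨ξ, subset_closure rfl⟩
  have hξη : ξ ⤳ η := specializes_iff_mem_closure.mpr hη
  have hne : η ≠ ξ := fun h => hnc (h ▸ hηc)
  -- so `ξ` is a maximal point of `XC`
  have hmax : ∀ ζ ∈ XC, ζ ⤳ ξ → ζ = ξ := fun ζ hζ hζξ =>
    (hchain ζ ξ η hζ hζξ hξη).elim id fun h => absurd h.symm hne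
  rcases hBsing ξ hξ with hsing | hB
  · -- at a maximal point of `XC` the reduced stalk is the residue field: regular
    apply hsing
    set Y : Closeds Z := ⟨closure XC, isClosed_closure⟩ with hY
    have hmp : ξ ∈ maxPoints (((vanishingIdeal Y).support : Set Z)) := by
      rw [Scheme.IdealSheafData.coe_support_vanishingIdeal]
      change ξ ∈ maxPoints (closure XC)
      rw [hcl]
      exact ⟨hξX, hmax⟩
    have hrad := radical_stalkIdeal_eq_maximalIdeal_of_mem_maxPoints hmp
    have heq : stalkIdeal (vanishingIdeal Y) ξ = maximalIdeal (Z.presheaf.stalk ξ) := by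
      rw [← hrad]
      exact (Ideal.radical_eq_iff.mpr (isRadical_stalkIdeal_vanishingIdeal Y ξ)).symm
    exact IsRegularLocalRing.of_ringEquiv (R := ResidueField (Z.presheaf.stalk ξ)) (Ideal.quotEquivOfEq heq.symm)
  · -- `ξ ∈ B`: but `ξ` is a specialisation of a point of `XC ∖ B`, which must be `ξ` itself
    have hξcl : ξ ∈ closure (XC ∩ Bᶜ) := by rw [← Set.sdiff_eq]; exact hNB hξX
    obtain ⟨a, ⟨haX, haB⟩, haξ⟩ := exists_mem_inter_specializes_of_mem_closure hXCc hBc.isOpen_compl hξcl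
    have h := hmax a haX haξ
    subst h
    exact haB hB

/-- An irreducible closed subset all of whose points are closed is a single point. [folklore] -/
theorem exists_eq_singleton_of_forall_isClosed {Z : Scheme.{u}} {P : Set Z} (hP : IsIrreducible P) (hPc : IsClosed P)
    (h : ∀ x ∈ P, IsClosed ({x} : Set Z)) : ∃ ξ : Z, P = {ξ} := by
  have hγ : IsGenericPoint hP.genericPoint P := by
    have h' := hP.isGenericPoint_genericPoint_closure
    rwa [hPc.closure_eq] at h'
  refine ⟨hP.genericPoint, ?_⟩
  calc P = closure {hP.genericPoint} := hγ.def.symm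
    _ = {hP.genericPoint} := (h _ hγ.mem).closure_eq

end NoCurveCentres

/-! ## §10 The points loop -/

namespace HostState

section PointsLoop

/-- The induction behind `points_loop`, on the number of points. [cite: BierstoneGrigorievMilmanWlodarczyk2011, §4 Step 2b] -/
private theorem points_loop_aux {E₀ : Scheme.{u}} {H₀ : E₀.IdealSheafData} (n : ℕ) :
    ∀ {E : Scheme.{u}} [IsIntegral E] [IsNoetherian E] {ρ : E ⟶ E₀} {H D : E.IdealSheafData}
      {L : List (E.IdealSheafData × ℕ)} (_S : HostState H D L) (_hseq : IsPureWeightedSeq 2 ρ H₀ H)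
      (_hexc : Scheme.IsExcellent E) (_hdim : topologicalKrullDim E ≤ 3)
      (_hcurve : ∀ x ∈ D.support, x ∈ (monomialIdeal L).support → 1 < Order.coheight x)
      {Z : Scheme.{u}} [IsNoetherian Z] (e : D.subscheme ≅ Z) {C : Z.IdealSheafData} (_hC : Scheme.IsRegular C.subscheme)
      {Zs : List (Closeds Z)} (_hlen : Zs.length = n) (_hne : Zs ≠ []) (_hP : IsPiecePartition C Zs)
      (_hpt : ∀ W ∈ Zs, ∃ ξ : Z, (W : Set Z) = {ξ} ∧
        e.inv ξ ∈ (((monomialIdeal L).comap D.subschemeι).support : Set D.subscheme))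
      {Z₁ : Scheme.{u}} {τ : Z₁ ⟶ Z} (_hτ : IsBlowup τ C),
      ∃ (E₁ : Scheme.{u}) (_ : IsIntegral E₁) (_ : IsNoetherian E₁) (ρ₁ : E₁ ⟶ E₀) (H₁ D₁ : E₁.IdealSheafData)
        (L₁ : List (E₁.IdealSheafData × ℕ)) (_ : HostState H₁ D₁ L₁) (e₁ : D₁.subscheme ≅ Z₁),
        IsPureWeightedSeq 2 ρ₁ H₀ H₁ ∧ Scheme.IsExcellent E₁ ∧ topologicalKrullDim E₁ ≤ 3 ∧
        (∀ x ∈ D₁.support, x ∈ (monomialIdeal L₁).support → 1 < Order.coheight x) ∧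
        (∀ y : D₁.subscheme, y ∈ (((monomialIdeal L₁).comap D₁.subschemeι).support : Set D₁.subscheme) →
            e.inv (τ (e₁.hom y)) ∈ (((monomialIdeal L).comap D.subschemeι).support : Set D.subscheme)) ∧
        (∀ y : D₁.subscheme, τ (e₁.hom y) ∉ (C.support : Set Z) →
            e.inv (τ (e₁.hom y)) ∈ (((monomialIdeal L).comap D.subschemeι).support : Set D.subscheme) →
              y ∈ (((monomialIdeal L₁).comap D₁.subschemeι).support : Set D₁.subscheme)) := by
  induction n with
  | zero =>
    intro E _ _ ρ H D L S hseq hexc hdim hcurve Z _ e C hC Zs hlen hne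
    exact absurd (List.eq_nil_of_length_eq_zero hlen) hne
  | succ n ih =>
    intro E _ _ ρ H D L S hseq hexc hdim hcurve Z _ e C hC Zs hlen hne hP hpt Z₁ τ hτ
    obtain ⟨W, Zs', rfl⟩ : ∃ W Zs', Zs = W :: Zs' := by
      cases Zs with
      | nil => exact absurd rfl hne
      | cons W Zs' => exact ⟨W, Zs', rfl⟩
    have hlen' : Zs'.length = n := by simpa using hlen
    -- the first piece: a closed point over the trace
    obtain ⟨ξ, hWξ, hξT⟩ := hpt W List.mem_cons_self
    have hξc : IsClosed ({ξ} : Set Z) := hWξ ▸ W.isClosed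
    have hWeq : W = (⟨{ξ}, hξc⟩ : Closeds Z) := Closeds.ext hWξ
    by_cases hnil : Zs' = []
    · /- ONE piece: `C = 𝓘({ξ})` -/
      subst hnil
      have hCW : C = vanishingIdeal W := by
        rw [← prod_pieceIdeals_eq_of_isRegular hC hP]; simp [pieceIdeals]
      have hτ' : IsBlowup τ (vanishingIdeal ⟨{ξ}, hξc⟩) := by rwa [hCW, hWeq] at hτ
      obtain ⟨E₁, hint, hnoeth, ρ₁, H₁, D₁, L₁, S₁, e₁, hseq₁, hexc₁, hdim₁, hcurve₁, hU, hL⟩ :=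
        S.point_step hseq hexc hdim hcurve e hξc hξT hτ'
      refine ⟨E₁, hint, hnoeth, ρ₁, H₁, D₁, L₁, S₁, e₁, hseq₁, hexc₁, hdim₁, hcurve₁, hU, fun y hy hyT => hL y ?_ hyT⟩
      intro h
      apply hy
      rw [hCW, hWeq, Scheme.IdealSheafData.coe_support_vanishingIdeal]
      exact h
    · /- SEVERAL pieces: peel the first point -/
      obtain ⟨X₁, τ₁, τ₂, hcomp, hτ₁, -, hiso, -, -, hτ₂, hC₁, hP₁⟩ := hτ.exists_comp_eq_of_isPiecePartition_cons hC hP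
      have hτ₁' : IsBlowup τ₁ (vanishingIdeal ⟨{ξ}, hξc⟩) := by rwa [hWeq] at hτ₁
      obtain ⟨E', hint', hnoeth', ρ', H', D', L', S', e', hseq', hexc', hdim', hcurve', hU', hL'⟩ :=
        S.point_step hseq hexc hdim hcurve e hξc hξT hτ₁'
      haveI := hint'
      haveI := hnoeth'
      haveI : IsNoetherian X₁ := isNoetherian_of_isBlowup hτ₁
      haveI := hiso
      -- the remaining points, pulled back: single closed points over the new trace
      have hpt₁ : ∀ W₁ ∈ Zs'.map (fun W₀ : Closeds Z => W₀.preimage τ₁.continuous), ∃ ξ₁ : X₁, (W₁ : Set X₁) = {ξ₁} ∧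
          e'.inv ξ₁ ∈ (((monomialIdeal L').comap D'.subschemeι).support : Set D'.subscheme) := by
        intro W₁ hW₁
        obtain ⟨W₂, hW₂, rfl⟩ := List.mem_map.mp hW₁
        obtain ⟨ξ₂, hW₂ξ, hξ₂T⟩ := hpt W₂ (List.mem_cons_of_mem _ hW₂)
        -- `ξ₂ ≠ ξ` (disjoint pieces), so `τ₁` is an isomorphism over a neighbourhood of `ξ₂`
        have hξ₂ξ : ξ₂ ≠ ξ := by
          intro h
          have hd := hP.disjoint_of_mem_tail hW₂
          rw [hWξ, hW₂ξ, h] at hd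
          exact Set.disjoint_singleton.mp hd rfl
        have hξ₂U : ξ₂ ∈ (W.compl : Set Z) := by
          rw [Closeds.coe_compl, hWξ]
          exact hξ₂ξ
        obtain ⟨ξ₁, hξ₁⟩ := exists_apply_eq_of_isIso_morphismRestrict τ₁ W.compl hξ₂U
        -- the fibre over `ξ₂` is the single point `ξ₁`
        have hfib : (τ₁ ⁻¹' ({ξ₂} : Set Z)) = {ξ₁} := by
          refine Set.Subsingleton.eq_singleton_of_mem ?_ (show τ₁ ξ₁ ∈ ({ξ₂} : Set Z) from hξ₁)
          rw [preimage_eq_image_ι_of_isIso_morphismRestrict τ₁ W.compl (Set.singleton_subset_iff.mpr hξ₂U)]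
          exact ((Set.subsingleton_singleton.preimage (Scheme.Opens.ι _).isOpenEmbedding.injective).preimage
            (τ₁ ∣_ W.compl).homeomorph.injective).image _
        refine ⟨ξ₁, ?_, ?_⟩
        · rw [Closeds.coe_preimage, hW₂ξ, hfib]
        · -- LOWER, off the fibre over `ξ`
          apply hL' (e'.inv ξ₁)
          · rw [hom_inv_apply, hξ₁]; exact hξ₂ξ
          · rw [hom_inv_apply, hξ₁]; exact hξ₂T
      have hne₁ : Zs'.map (fun W₀ : Closeds Z => W₀.preimage τ₁.continuous) ≠ [] := by simpa using hnil
      have hlen₁ : (Zs'.map (fun W₀ : Closeds Z => W₀.preimage τ₁.continuous)).length = n := by simpa using hlen'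
      obtain ⟨E₁, hint₁, hnoeth₁, ρ₁, H₁, D₁, L₁, S₁, e₁, hseq₁, hexc₁, hdim₁, hcurve₁, hU₁, hL₁⟩ :=
        ih S' hseq' hexc' hdim' hcurve' e' hC₁ hlen₁ hne₁ hP₁ hpt₁ hτ₂
      refine ⟨E₁, hint₁, hnoeth₁, ρ₁, H₁, D₁, L₁, S₁, e₁, hseq₁, hexc₁, hdim₁, hcurve₁, fun y hy => ?_,
        fun y hyC hyT => ?_⟩
      · -- UPPER composes
        have h2 := hU' (e'.inv (τ₂ (e₁.hom y))) (hU₁ y hy)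
        have hc : τ₁ (τ₂ (e₁.hom y)) = τ (e₁.hom y) := by rw [← hcomp, Scheme.Hom.comp_apply]
        rwa [hom_inv_apply, hc] at h2
      · -- LOWER composes: `τ (e₁ y) = τ₁ v` with `v := τ₂ (e₁ y)` off `V(C) = W ∪ ⋃ Zs'`
        set v : X₁ := τ₂ (e₁.hom y) with hv
        have hτv : τ₁ v = τ (e₁.hom y) := by rw [hv, ← Scheme.Hom.comp_apply, hcomp]
        have hvξ : τ₁ v ≠ ξ := by
          intro h
          apply hyC
          rw [← hτv, ← hP.2]
          exact Set.mem_iUnion₂.mpr ⟨W, List.mem_cons_self, by rw [hWξ]; exact h⟩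
        have hu : e'.inv v ∈ (((monomialIdeal L').comap D'.subschemeι).support : Set D'.subscheme) := by
          apply hL' (e'.inv v)
          · rw [hom_inv_apply]; exact hvξ
          · rw [hom_inv_apply, hτv]; exact hyT
        refine hL₁ y ?_ hu
        -- `v ∉ V(C₁) = τ₁⁻¹(⋃ Zs')`
        rw [← hP₁.2]
        intro hmem
        obtain ⟨W₁, hW₁, hvW₁⟩ := Set.mem_iUnion₂.mp hmem
        obtain ⟨W₂, hW₂, rfl⟩ := List.mem_map.mp hW₁
        apply hyC
        rw [← hτv, ← hP.2]
        exact Set.mem_iUnion₂.mpr ⟨W₂, List.mem_cons_of_mem _ hW₂, hvW₁⟩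

/-- [OURS · L1 W5.2] **THE POINTS LOOP** (§10 of the module docstring): a blowing up `τ` of the CJS surface `Z ≅ V(D)` along a regular
centre whose pieces are closed points over the trace is matched, point by point, by point moves of the threefold; the state, the
identification `V(D₁) ≅ Z₁` and the UPPER/LOWER trace bookkeeping (relative to `τ`, LOWER off the centre) come out at the end.
[cite: BierstoneGrigorievMilmanWlodarczyk2011, §4 Step 2b] [cite: StacksProject, Tag 080A] -/
theorem points_loop {E₀ E : Scheme.{u}} [IsIntegral E] [IsNoetherian E] {ρ : E ⟶ E₀} {H₀ : E₀.IdealSheafData}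
    {H D : E.IdealSheafData} {L : List (E.IdealSheafData × ℕ)} (S : HostState H D L) (hseq : IsPureWeightedSeq 2 ρ H₀ H)
    (hexc : Scheme.IsExcellent E) (hdim : topologicalKrullDim E ≤ 3)
    (hcurve : ∀ x ∈ D.support, x ∈ (monomialIdeal L).support → 1 < Order.coheight x)
    {Z : Scheme.{u}} [IsNoetherian Z] (e : D.subscheme ≅ Z) {C : Z.IdealSheafData} (hC : Scheme.IsRegular C.subscheme)
    {Zs : List (Closeds Z)} (hne : Zs ≠ []) (hP : IsPiecePartition C Zs)
    (hpt : ∀ W ∈ Zs, ∃ ξ : Z, (W : Set Z) = {ξ} ∧ e.inv ξ ∈ (((monomialIdeal L).comap D.subschemeι).support : Set D.subscheme))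
    {Z₁ : Scheme.{u}} {τ : Z₁ ⟶ Z} (hτ : IsBlowup τ C) :
    ∃ (E₁ : Scheme.{u}) (_ : IsIntegral E₁) (_ : IsNoetherian E₁) (ρ₁ : E₁ ⟶ E₀) (H₁ D₁ : E₁.IdealSheafData)
      (L₁ : List (E₁.IdealSheafData × ℕ)) (_ : HostState H₁ D₁ L₁) (e₁ : D₁.subscheme ≅ Z₁),
      IsPureWeightedSeq 2 ρ₁ H₀ H₁ ∧ Scheme.IsExcellent E₁ ∧ topologicalKrullDim E₁ ≤ 3 ∧
      (∀ x ∈ D₁.support, x ∈ (monomialIdeal L₁).support → 1 < Order.coheight x) ∧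
      (∀ y : D₁.subscheme, y ∈ (((monomialIdeal L₁).comap D₁.subschemeι).support : Set D₁.subscheme) →
          e.inv (τ (e₁.hom y)) ∈ (((monomialIdeal L).comap D.subschemeι).support : Set D.subscheme)) ∧
      (∀ y : D₁.subscheme, τ (e₁.hom y) ∉ (C.support : Set Z) →
          e.inv (τ (e₁.hom y)) ∈ (((monomialIdeal L).comap D.subschemeι).support : Set D.subscheme) →
            y ∈ (((monomialIdeal L₁).comap D₁.subschemeι).support : Set D₁.subscheme)) :=
  points_loop_aux Zs.length S hseq hexc hdim hcurve e hC rfl hne hP hpt hτ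

end PointsLoop

end HostState

end DepthLegal

end Summit.ResolutionOfSingularities.ResolutionOfSingularities.Theorems
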